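import Summits.QuantumFields.YangMills.Theorems.UnitScaleTiltProp8ChartOneStep
import Summits.QuantumFields.YangMills.Theorems.UnitScaleTiltProp8ChartDiffLocal
import Literature.Analysis.Complex.GateauxHolomorphicBall
import Literature.MathematicalPhysics.QuantumFieldTheory.Balaban1983to89.BlockAveragingFederbush
import Literature.MathematicalPhysics.QuantumFieldTheory.Balaban1983to89.Beta.BackgroundVertices
import HarnessLib

/-!
# BalabanUVNodes ∕ node N18 = NE5 — closure-ledger item (iii), (R3), FILE A (preliminaries): THE CAUCHY ROAD, THE EXPONENTIAL CHART IN THE UNITS, AND THE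
# LINEAR PART `Q₁` OF THE (0.4) AVERAGE AS A DIFFERENTIABLE, TWO-BLOCK-LOCAL FUNCTION OF THE BOND FIELD
# (Track A, DAG node N18 = `T4OutputRate.NE5` :211; cluster K4 «SpineRates», item K3⁷ `SpineGivenEndpointR13SepCoPH`; seat pub-ymgap-dag-n18-w3 g3)

CREDIT.  Homes the LENS seat's farm-checked scratch `ym-lens-BalabanUVNodes-transfer` g31 `LensTransferSketch31.lean` (memo `LENS-transfer.md` §37, Card T48; bus
2026-08-27 [LENS-TRANSFER-G31]) per its close-out pointer «home the files `--kind proof --supports 20544 --as helper` WITH CREDIT» (g35, [LENS-TRANSFER-G35-0] (3)).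
The mathematics and the proofs are the lens's; the re-cut for the tree is this seat's: NO new definitions — the chart family is the tree's
`Beta.BackgroundVertices.expUnit ℂ` bondwise, the remainder functional `R_c(S) := Ū(S)(c) − 1 − (Q₁(S − 1))(c)` is written out (as in dag-n18-d's module 25), the
two-block zero extension is a proof device.

HONEST FRAMING.  Count-neutral kernel bookkeeping (`--supports stmt-QuantumFields-20544 --as helper`): one Schwarz-on-lines call on UST's holomorphy + C⁰ bound;
nothing of Bałaban's analysis asserted beyond the cited tree theorems; constants not optimised (`21120`∕`84480` vs module 25's `181`: absorbed in the envelope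
constant of the radii family L's bootstrap); the chart-in∕chart-out letters, the (1.12)∕(1.13) letters, `TΦ`∕`Tcfg`∕`w` are NOT here; NE5 NOT PRINTED ∕ NOT
proved; N18 NOT discharged; finite tori — nothing about the continuum ∕ OS ∕ mass gap ∕ Clay.

WHY (lens memo §37).  Item 3 of `N18-BETA-SPEC.md` (the (1.13) half, ORBIT form) averages ONE small units-valued field per cube with a complex leg: the carrier is
`(M_N(ℂ))ˣ`, not `SU(N)`.  dag-n18-d's (β2) Lipschitz remainder `norm_avgRem_sub_avgRem_le` (module 25, `181ℓ²δ·sup‖U − U′‖`) is the `SU(N) × SU(N)` REAL edition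
with the GUARDED average and does not cover that carrier.  King's engine ([King1986] (3.43)–(3.47): the fluctuation functionals are ANALYTIC and every Lipschitz
letter is a Cauchy estimate) gives the complex-leg twin WITHOUT re-running the telescoping: `Y ↦ R_c(e^Y)` is G-holomorphic on the sup-ball of bond fields
(UST `Prop8Chart.differentiableAt_coe_emlAvgU_of_twoBlock` + `exp_analytic`) with the QUADRATIC sup bound `660ℓ²s²` (UST `Prop8Chart.norm_emlAvgU_sub_one_sub_linAvg_le`),
so ONE application of `Literature.Analysis.Complex.GateauxHolomorphic.norm_sub_le_of_gateaux` gives the twin with the right smallness factor.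

WHAT (this file = §0–§2; the remainder estimates §3–§7 are FILE B `…N18AvgRemainderUnitsLipschitz`).
* §0 `norm_sub_le_of_quadratic_remainder` — the Cauchy road: G-holomorphic + `‖R‖ ≤ K(2δ)²` on the `2δ`-ball ⇒ `8Kδ`-Lipschitz between `δ`-close points of the `δ`-ball.
* §1 the chart `b ↦ e^{Y(b)}` in the units (`expUnit ℂ`): `coe_expUnit`, `differentiableAt_coe_expUnit`, `norm_coe_expUnit_sub_one_le`.
* §2 `differentiableAt_walkSum_of_steps`, `walkSum_congr`, `differentiableAt_linAvg`, `linAvg_congr₂` (signed sums ∕ `Q₁` differentiable and two-block local).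
* §3 the remainder `R_c(S) = Ū(S)(c) − 1 − Q₁(S − 1)(c)` (written out): `avgRemU_congr₂` (two-block local), and in the chart `S = e^Y`: `one_le_ell`,
  `differentiableAt_avgRemE` (`8ℓr < 1`), `norm_avgRemE_le` (`≤ 2640ℓ²r²`, `96ℓr ≤ 1`), `avgRemE_congr₂`.
* §4 ★ `norm_avgRemE_sub_avgRemE_le_of_lt` (Cauchy case), ★ `norm_avgRemE_sub_avgRemE_le`: `‖Y‖, ‖Y′‖ ≤ δ`, `192ℓδ ≤ 1` ⟹
  `‖R_c(e^{Y′}) − R_c(e^{Y})‖ ≤ 21120·ℓ²·δ·‖Y′ − Y‖`, ALL `M_N(ℂ)`-valued `Y` (`ℓ = (d+2)L`, sup norms).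
* §5 ★ `norm_avgRemE_sub_avgRemE_le_local` (two-block hypotheses only).
* §6 ★★ `norm_avgRemU_sub_avgRemU_le` — NO CHART, module 25's letters on the units carrier: `‖S(b) − 1‖, ‖S′(b) − 1‖ ≤ s`, `‖S′(b) − S(b)‖ ≤ ε` two-block,
  `384ℓs ≤ 1` ⟹ `‖R_c(S′) − R_c(S)‖ ≤ 84480·ℓ²·s·ε`.
* §7 `avgRemU_unitsField_eq` — the `SU(N)` leg on the guard IS module 25's remainder with the GUARDED average (UST (T1) `coe_emlAvgU_unitsField`).

0 `def`, 0 `sorry`.  References: C. King, CMP **102** (1986) 649–677 [King1986] ((3.43)–(3.47) p.661); T. Bałaban, CMP **98** (1985) 17–51 [Balaban1985Averaging]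
(Prop. 3 (122)–(125) p.36); CMP **109** (1987) 249–301 [Balaban1987RG1] ((0.4) p.253, (1.12) p.262).
-/

noncomputable section

open scoped BigOperators
open NormedSpace Metric Set

namespace YMDAG.N18.AvgRemainderUnits

open Literature.MathematicalPhysics.QuantumFieldTheory.Balaban1983to89
open T4Continuum BlockAveraging AveragingRT ExpMeanLog MatrixLog BlockAveragingEMLLinearised
open Summit.QuantumFields.YangMills.Theorems.Prop8Chart
open Literature.Analysis.Complex
open Beta.BackgroundVertices (expUnit)

/-! ## §0  The Cauchy road (lens T42; Sketch27 §12) -/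

section CauchyRoad

variable {𝔛 : Type*} [NormedAddCommGroup 𝔛] [NormedSpace ℂ 𝔛] {F : Type*} [NormedAddCommGroup F] [NormedSpace ℂ F]

/-- **T42 (Cauchy road)**: a map G-holomorphic on the `2δ`-ball with a QUADRATIC sup bound `‖R y‖ ≤ K·(2δ)²` there is Lipschitz with constant
`8Kδ` between points of the `δ`-ball less than `δ` apart — one application of `GateauxHolomorphic.norm_sub_le_of_gateaux`.
[cite: King1986, (3.43)-(3.47) p.661] -/
theorem norm_sub_le_of_quadratic_remainder {R : 𝔛 → F} {δ K : ℝ} (hδ : 0 < δ)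
    (hG : ∀ a ∈ ball (0 : 𝔛) (2 * δ), ∀ v : 𝔛,
      DifferentiableOn ℂ (fun z : ℂ => R (a + z • v)) {z : ℂ | a + z • v ∈ ball (0 : 𝔛) (2 * δ)})
    (hM : ∀ y ∈ ball (0 : 𝔛) (2 * δ), ‖R y‖ ≤ K * (2 * δ) ^ 2) {x y : 𝔛} (hx : ‖x‖ ≤ δ) (hy : ‖y - x‖ < δ) :
    ‖R y - R x‖ ≤ 8 * K * δ * ‖y - x‖ := by
  have hxb : x ∈ ball (0 : 𝔛) (2 * δ) := by rw [mem_ball, dist_zero_right]; linarith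
  have hdist : dist x 0 = ‖x‖ := dist_zero_right x
  have hh : ‖y - x‖ < 2 * δ - dist x 0 := by rw [hdist]; linarith
  have key := GateauxHolomorphic.norm_sub_le_of_gateaux hG hM hxb hh
  rw [add_sub_cancel, hdist] at key
  have hK : 0 ≤ K := by
    have h0 := hM 0 (mem_ball_self (by linarith))
    by_contra hK
    have h5 : K * (2 * δ) ^ 2 < 0 := mul_neg_of_neg_of_pos (lt_of_not_ge hK) (by positivity)
    linarith [norm_nonneg (R 0)]
  have hden : δ ≤ 2 * δ - ‖x‖ := by linarith
  calc ‖R y - R x‖ ≤ 2 * (K * (2 * δ) ^ 2) / (2 * δ - ‖x‖) * ‖y - x‖ := key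
    _ ≤ 2 * (K * (2 * δ) ^ 2) / δ * ‖y - x‖ := by gcongr
    _ = 8 * K * δ * ‖y - x‖ := by field_simp; ring

end CauchyRoad

variable {P : Params} {j : ℕ}

/-! ## §1  The exponential chart `b ↦ e^{Y(b)}` in the units (`Beta.BackgroundVertices.expUnit ℂ`, bondwise) -/

section ExpChart

variable {𝔸 : Type*} [NormedRing 𝔸] [NormedAlgebra ℂ 𝔸] [CompleteSpace 𝔸]

/-- the value of a charted bond variable `e^{a}` read as a unit. [cite: Balaban1987RG1, (1.12) p.262] -/
theorem coe_expUnit (a : 𝔸) : ((expUnit ℂ a : 𝔸ˣ) : 𝔸) = exp a := rfl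

/-- every charted bond variable `Y ↦ e^{Y(b)}` depends ℂ-differentiably on the field, everywhere. [folklore] -/
theorem differentiableAt_coe_expUnit (b : PBond P j) (Y₀ : PBond P j → 𝔸) :
    DifferentiableAt ℂ (fun Y : PBond P j → 𝔸 => ((expUnit ℂ (Y b) : 𝔸ˣ) : 𝔸)) Y₀ :=
  (exp_analytic _).differentiableAt.comp Y₀ (ContinuousLinearMap.proj (R := ℂ) (φ := fun _ : PBond P j => 𝔸) b).differentiableAt

/-- near-flatness of the charted bond variable: `‖e^{Y(b)} − 1‖ ≤ 2‖Y(b)‖` for `‖Y(b)‖ ≤ 1`. [folklore] -/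
theorem norm_coe_expUnit_sub_one_le (Y : PBond P j → 𝔸) (b : PBond P j) (h : ‖Y b‖ ≤ 1) :
    ‖((expUnit ℂ (Y b) : 𝔸ˣ) : 𝔸) - 1‖ ≤ 2 * ‖Y b‖ :=
  B7TransferAnalyticMean.norm_exp_sub_one_le_two_mul h

end ExpChart

/-! ## §2  Signed sums and the linearised average of a differentiable family; two-block locality -/


section Linear

variable {V : Type*} [NormedAddCommGroup V] [NormedSpace ℂ V]
variable {E : Type*} [NormedAddCommGroup E] [NormedSpace ℂ E]

/-- a signed sum along a walk is differentiable in the parameter as soon as the bond variables on the walk are. [folklore] -/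
theorem differentiableAt_walkSum_of_steps {G : E → PBond P j → V} {x₀ : E} :
    ∀ γ : List (LStep P j), (∀ st ∈ γ, DifferentiableAt ℂ (fun x => G x st.bond) x₀) →
      DifferentiableAt ℂ (fun x => walkSum (G x) γ) x₀
  | [], _ => by
    simp only [walkSum_nil]
    exact differentiableAt_const _
  | st :: γ, h => by
    have ih := differentiableAt_walkSum_of_steps γ fun s hs => h s (List.mem_cons_of_mem _ hs)
    have hb : DifferentiableAt ℂ (fun x => G x st.bond) x₀ := h st (by simp)
    by_cases hf : st.fwd = true
    · have hfun : (fun x => walkSum (G x) (st :: γ)) = fun x => G x st.bond + walkSum (G x) γ := by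
        funext x; rw [walkSum_cons, if_pos hf]
      rw [hfun]
      exact hb.add ih
    · have hfun : (fun x => walkSum (G x) (st :: γ)) = fun x => -G x st.bond + walkSum (G x) γ := by
        funext x; rw [walkSum_cons, if_neg hf]
      rw [hfun]
      exact hb.neg.add ih

end Linear

section WalkCongr

variable {V : Type*} [AddCommGroup V]

/-- a signed sum depends only on the bond variables on its walk. [folklore] -/
theorem walkSum_congr {Y Y' : PBond P j → V} (γ : List (LStep P j)) (h : ∀ st ∈ γ, Y st.bond = Y' st.bond) :
    walkSum Y γ = walkSum Y' γ := by
  unfold walkSum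
  congr 1
  exact List.map_congr_left fun st hst => by rw [h st hst]

end WalkCongr

section LinAvg

open scoped Matrix.Norms.L2Operator

variable {E : Type*} [NormedAddCommGroup E] [NormedSpace ℂ E]
variable {n : Type*} [Fintype n] [DecidableEq n] [Nonempty n]

omit [Nonempty n] in
/-- **`Q₁` OF A DIFFERENTIABLE FAMILY IS DIFFERENTIABLE** (a finite signed sum). [cite: Balaban1985Averaging, (124)-(125) p.36] -/
theorem differentiableAt_linAvg {G : E → PBond P j → Matrix n n ℂ} {x₀ : E} (c : PBond P (j + 1))
    (hG : ∀ b : PBond P j, DifferentiableAt ℂ (fun x => G x b) x₀) :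
    DifferentiableAt ℂ (fun x => linAvg (G x) c) x₀ := by
  have h : (fun x => linAvg (G x) c) = fun x => ((Fintype.card (Idx P) : ℂ))⁻¹ • ∑ i : Idx P,
      (walkSum (G x) (walk (emb c.src) (stairWord i.2.1 (off i.1))) +
        walkSum (G x) (walk (walkEnd (emb c.src) (stairWord i.2.1 (off i.1))) (List.replicate P.L (c.dir, true))) -
        walkSum (G x) (walk (emb c.tgt) (stairWord i.2.2 (off i.1)))) := by
    funext x; rw [linAvg_def]
  rw [h]
  have hs : DifferentiableAt ℂ (fun x => ∑ i : Idx P,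
      (walkSum (G x) (walk (emb c.src) (stairWord i.2.1 (off i.1))) +
        walkSum (G x) (walk (walkEnd (emb c.src) (stairWord i.2.1 (off i.1))) (List.replicate P.L (c.dir, true))) -
        walkSum (G x) (walk (emb c.tgt) (stairWord i.2.2 (off i.1))))) x₀ :=
    DifferentiableAt.fun_sum fun i _ =>
      ((differentiableAt_walkSum_of_steps _ fun st _ => hG st.bond).add
        (differentiableAt_walkSum_of_steps _ fun st _ => hG st.bond)).sub
        (differentiableAt_walkSum_of_steps _ fun st _ => hG st.bond)
  exact hs.const_smul (((Fintype.card (Idx P) : ℂ))⁻¹)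

omit [Fintype n] [DecidableEq n] [Nonempty n] in
/-- **`Q₁` IS TWO-BLOCK LOCAL**: `(Q₁Z)(c)` depends only on the bond variables with both ends in the two blocks of `c` (the staircases stay in their block,
`blockOf_ends_of_mem_stairWalk`; the middle segment is a segment of a (0.4) loop, `two_block_of_mem_loopWalk`). [cite: Balaban1985Averaging, (124)-(125) p.36] -/
theorem linAvg_congr₂ (hj : j + 1 ≤ P.m + P.K) (c : PBond P (j + 1)) {Z Z' : PBond P j → Matrix n n ℂ}
    (h : ∀ b : PBond P j, (blockOf b.src = c.src ∨ blockOf b.src = c.tgt) → (blockOf b.tgt = c.src ∨ blockOf b.tgt = c.tgt) → Z b = Z' b) :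
    linAvg Z c = linAvg Z' c := by
  rw [linAvg_def, linAvg_def]
  congr 1
  refine Finset.sum_congr rfl fun i _ => ?_
  have hA : walkSum Z (walk (emb c.src) (stairWord i.2.1 (off i.1))) = walkSum Z' (walk (emb c.src) (stairWord i.2.1 (off i.1))) :=
    walkSum_congr _ fun st hst => by
      obtain ⟨h1, h2⟩ := blockOf_ends_of_mem_stairWalk hj c.src i.1 i.2.1 st hst
      exact h st.bond (Or.inl h1) (Or.inl h2)
  have hC : walkSum Z (walk (emb c.tgt) (stairWord i.2.2 (off i.1))) = walkSum Z' (walk (emb c.tgt) (stairWord i.2.2 (off i.1))) :=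
    walkSum_congr _ fun st hst => by
      obtain ⟨h1, h2⟩ := blockOf_ends_of_mem_stairWalk hj c.tgt i.1 i.2.2 st hst
      exact h st.bond (Or.inr h1) (Or.inr h2)
  have hB : walkSum Z (walk (walkEnd (emb c.src) (stairWord i.2.1 (off i.1))) (List.replicate P.L (c.dir, true))) =
      walkSum Z' (walk (walkEnd (emb c.src) (stairWord i.2.1 (off i.1))) (List.replicate P.L (c.dir, true))) :=
    walkSum_congr _ fun st hst => by
      have hmem : st ∈ walk (emb c.src) (loopWord P.L c.dir (off i.1) i.2.1 i.2.2) := by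
        unfold loopWord; rw [walk_append, walk_append]; simp [hst]
      exact h st.bond (two_block_of_mem_loopWalk hj c i hmem).1 (two_block_of_mem_loopWalk hj c i hmem).2
  rw [hA, hB, hC]

end LinAvg


end YMDAG.N18.AvgRemainderUnits

end
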